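import Summits.BirchSwinnertonDyer.BirchSwinnertonDyer.Theorems.ClassRecordThreeCornerAtThreeCoChainDefs
import Summits.BirchSwinnertonDyer.BirchSwinnertonDyer.Theorems.ClassRecordThreeCornerAtThreeBranchesDefs
import Summits.BirchSwinnertonDyer.BirchSwinnertonDyer.Theorems.ErratumRoadFiveIMCDivOneSidedNoFiniteSubmoduleFree
import Summits.BirchSwinnertonDyer.Rank1Residual.X11b.Three.StepLHalves
import Literature.NumberTheory.EllipticCurves.CastellaGrossiSkinner2025.CongruenceArgumentProofs
import Literature.NumberTheory.EllipticCurves.UnrIntegersUnits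
import Literature.NumberTheory.EllipticCurves.Hsieh2014.AnticyclotomicMuInvariant
import HarnessLib

/-!
# Crux idea `mu-calibrated-eisenstein-lower-half-at-mult-3` (item stmt-BirchSwinnertonDyer-21420 `CornerAtThreeW`,
# STEP L conjunct `Three.CornerStepLAt` = the XL stub `stub_cornerStepL3` of the line of record) — typed candidate
# Props + the PROVED kernel glue (planner sketch, cell `bsd-stepL`, seat `bsd-stepL-mult-idea` g11).
# Nothing asserted about any curve; no `sorry`.

THE LEVER (informal; the card `idea-mu-calibrated-eisenstein-lower-half-at-mult-3.md`). Conjunct (L) of the corner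
crux is ONE-SIDED: `Ch_Λ(X_ac^∅)·R₀⟦T⟧ ⊆ (L_𝔭^BDP)` (Eisenstein direction) read at `𝟙`. Eisenstein-direction
divisibilities never use the residual IMAGE (no Kolyvagin τ, no (im)/(sur)/(ram)); what they lose without big image
is INTEGRALITY: Skinner–Urban's three-variable GU(2,2) divisibility (Thm. 7.7 + Prop. 13.6(1)) holds under (irr_ℚ)
alone AWAY FROM the height-one primes pulled back from the cyclotomic algebra `Λ_K⁺` (Yan–Zhu 2026 Thm. 1.6), and
after the Beilinson–Flach translation (BSTW Prop. 9.18 = YZ Thm. 4.7) and the descent `γ⁺ ↦ 1` to the anticyclotomic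
line, such primes become NON-ZERO CONSTANTS of `R₀ = W(𝔽̄₃)`, i.e. powers of `3`: on the corner one gets (K1)
`∃ k, ∀ g ∈ Ch·R₀⟦T⟧, L ∣ 3^k·g`. The CALIBRATION is analytic and image-free: `μ(L_𝔭^BDP) = 0` (K2; Hsieh 2014
Thm. B — hypotheses: `p` odd, `p ∥ N` allowed (tree fact `Hsieh2014.thmB_exists_isHsiehLFunction_coeff_norm_eq_one`
carries only `¬ p² ∣ N`), `ρ̄|_{G_K}` ABSOLUTELY IRREDUCIBLE — which HOLDS on the corner: the image is `N(C_s) ≅ D₄`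
or `N(C_ns) ≅ SD₁₆` and `K ∩ ℚ(E[3]) = ℚ` for every odd Heegner `K`). Then pure `R₀⟦T⟧`-algebra (R₀ a DVR with
uniformizer `3`: tree `CongruenceDescent.prime_natCast_p_unrIntegers`; laundering = tree
`CastellaGrossiSkinner2025.dvd_of_mul_eq_C_pow_mul` at `μ = 0`) gives the INTEGRAL divisibility (corner H3), and the
tree's read-at-`𝟙` (`imcLowerWaldspurgerOnTreeAt_of_value_of_dvd`) with the corner H1/H2/CTL₀ frames of card D gives
`Three.CornerStepLAt W` for EVERY corner curve (3Ns 194 + 3Nn 102 = 296/296 pairs of the census: no TW condition,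
no CM anchor, no auxiliary twist).

What is typed here, over tree declarations only:
* `CornerLowerDivUpToPowerAt W` — K1 (crux, rank 2): the Eisenstein («⊆») divisibility UP TO A POWER OF `3`, ideal
  level, on every corner frame and every Castella-normalised BDP frame `L`.
* `CornerBDPMuZeroAt W` — K2 (crux, rank 3, near-print): `μ(L) = 0` in Hsieh's currency (a coefficient of norm one).
* `CornerLowerDivAt W` — the corner twin of `Three.IMCDivAt₃` (H3 VERBATIM with `¬ Surj W 3`): the INTEGRAL target.
* `CornerBDPExistsAt W`, `CornerBDPValueAt W`, `CornerCharValuedAt W` — card D's corner H1/H2/CTL₀ frames VERBATIM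
  (same text ⇒ same items if ever filed; restated here only because Cruxes files are not importable).
* `CornerHsiehTransferAt` — S2 (support): Hsieh's named fact ⟹ K2 (the comparison Hsieh-frame ↔ Castella-frame up to
  `R₀⟦T⟧ˣ` + absolute irreducibility over `K` on the corner), typed as an implication between Props.
KERNEL (no sorry): `not_C_three_dvd_of_coeff_norm_eq_one` (norm-one coefficient ⟹ `3 ∤ L`),
`cornerLowerDivAt_of_upToPower_of_muZero` (K1 ∧ K2 ⟹ corner H3), `cornerStepLAt_of_muCalibration`
(⊢ `Three.CornerStepLAt W`), `cornerAtThreeStepL_of_muCalibration` (⊢ the registered stub constant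
`Theorems.CornerAtThreeStepL`).
-/

noncomputable section

open scoped Classical NumberField

open WeierstrassCurve NumberField IsDedekindDomain Field PowerSeries Literature.NumberTheory.Automorphic
  Literature.NumberTheory.EllipticCurves Literature.NumberTheory.EllipticCurves.ModularForms
  Literature.NumberTheory.EllipticCurves.Rank1Residual
  Literature.NumberTheory.GaloisRepresentations
  Summit.BirchSwinnertonDyer.Rank1Residual Summit.BirchSwinnertonDyer.Rank1Residual.X11b
  Summit.BirchSwinnertonDyer.Rank1Residual.X11b.AcSelmer
  Summit.BirchSwinnertonDyer.Rank1Residual.X11b.Halves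
  Summit.BirchSwinnertonDyer.Rank1Residual.X11b.Three

set_option linter.dupNamespace false
set_option autoImplicit false

namespace Summit.BirchSwinnertonDyer.BirchSwinnertonDyer.Cruxes.CornerAtThreeW.MuCalibratedEisenstein

variable (W : WeierstrassCurve ℚ) [W.IsElliptic] [W.IsGloballyMinimal]

/-! ### §1 The corner frames' analytic inputs (card D's H1/H2/CTL₀ VERBATIM; typed, not attempted) -/

/-- **H1 on the corner** — `Three.BDPExistsAt₃ W` VERBATIM with `Surj W 3` replaced by `¬ Surj W 3`: a BDP frame
`(ι', Ω_K, Ω_p, L)` of the newform at `3 ∥ N` exists on every corner frame (item 20448's `p ∥ N` object; LZZ18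
Thm. 1.5.1/1.5.3 shape; CONSTRUCTION missing in print at `p ∣ N` for Castella's normalisation). TYPED, not attempted. -/
@[conjecture]
def CornerBDPExistsAt : Prop :=
  ∀ (N : ℕ) [NeZero N] (K : Type) [Field K] [NumberField K] (Dt : ModularParametrizationData W N)
    (H : HeegnerDatum N (NumberField.discr K)) (ι : K →+* ℂ) (P : (W.baseChange K).toAffine.Point),
    ClassX11b W 3 → ¬ Surj W 3 → W.conductorNorm ℤ = N → IsImaginaryQuadratic K →
    Odd (NumberField.discr K) → SatisfiesHeegnerHypothesis N K →
    (W.quadraticTwist (NumberField.discr K : ℚ)).entireLFunction 1 ≠ 0 →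
    WeierstrassCurve.Affine.Point.map ι.toRatAlgHom P = heegnerPointComplex Dt H →
    ¬ (3 : ℤ) ∣ Dt.c → ¬ IsOfFinAddOrder P →
    ∀ (κ : ZpExtension K 3), κ.IsAnticyclotomic →
      ∀ (γ : Field.absoluteGaloisGroup K) [Fact (κ.IsTopGenerator γ)]
        (𝔭 : HeightOneSpectrum (𝓞 K)), ((3 : ℕ) : 𝓞 K) ∈ 𝔭.asIdeal →
        𝔭.asIdeal.ramificationIdx (𝓞 ℚ) = 1 → 𝔭.asIdeal.inertiaDeg (𝓞 ℚ) = 1 →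
        ∀ (f : CuspForm (CongruenceSubgroup.Gamma0 N) 2), IsNewformOf W f →
          ∃ ι' : PadicAlgCl 3 ≃+* ℂ, InducesPrime ι' 𝔭 ∧
            ∃ (ΩK : ℂ) (Ωp : (unrIntegers 3)ˣ) (L : UnrSeries 3),
              ΩK ≠ 0 ∧ IsBDPLFunction ι' 𝔭 κ γ f ΩK ((Ωp : unrIntegers 3) : ℂ_[3]) L

/-- **H2 on the corner** — `Three.BDPValueAt₃ W` VERBATIM with `¬ Surj W 3`: the BDP/Waldspurger value at `𝟙`,
`L(0) = u·((1 − a₃·3⁻¹)·log_ω P)²`, `u ∈ R₀ˣ` (Castella 2018 Thm. 3.2 shape; formal in the frame). TYPED, not attempted. -/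
@[conjecture]
def CornerBDPValueAt : Prop :=
  ∀ (N : ℕ) [NeZero N] (K : Type) [Field K] [NumberField K] (Dt : ModularParametrizationData W N)
    (H : HeegnerDatum N (NumberField.discr K)) (ι : K →+* ℂ) (P : (W.baseChange K).toAffine.Point),
    ClassX11b W 3 → ¬ Surj W 3 → W.conductorNorm ℤ = N → IsImaginaryQuadratic K →
    Odd (NumberField.discr K) → SatisfiesHeegnerHypothesis N K →
    (W.quadraticTwist (NumberField.discr K : ℚ)).entireLFunction 1 ≠ 0 →
    WeierstrassCurve.Affine.Point.map ι.toRatAlgHom P = heegnerPointComplex Dt H →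
    ¬ (3 : ℤ) ∣ Dt.c → ¬ IsOfFinAddOrder P →
    ∀ (κ : ZpExtension K 3), κ.IsAnticyclotomic →
      ∀ (γ : Field.absoluteGaloisGroup K) [Fact (κ.IsTopGenerator γ)]
        (𝔭 : HeightOneSpectrum (𝓞 K)) (h𝔭 : ((3 : ℕ) : 𝓞 K) ∈ 𝔭.asIdeal)
        (he : 𝔭.asIdeal.ramificationIdx (𝓞 ℚ) = 1) (hf : 𝔭.asIdeal.inertiaDeg (𝓞 ℚ) = 1),
        ∀ (f : CuspForm (CongruenceSubgroup.Gamma0 N) 2), IsNewformOf W f →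
          ∀ (ι' : PadicAlgCl 3 ≃+* ℂ), InducesPrime ι' 𝔭 →
            ∀ (ΩK : ℂ) (Ωp : (unrIntegers 3)ˣ) (L : UnrSeries 3), ΩK ≠ 0 →
              IsBDPLFunction ι' 𝔭 κ γ f ΩK ((Ωp : unrIntegers 3) : ℂ_[3]) L →
                ∃ u : (unrIntegers 3)ˣ, L.HasValueAt 0 (((u : unrIntegers 3) : ℂ_[3]) *
                  (algebraMap ℚ_[3] ℂ_[3] (((1 : ℚ_[3]) - ((W.LFunction 3 : ℤ) : ℚ_[3]) * (3 : ℚ_[3])⁻¹) *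
                    logOmega W 3 (embAt K 3 𝔭 h𝔭 he hf) P)) ^ 2)

/-- **CTL₀ on the corner** — `Ch_Λ(X_ac^∅)` is torsion with a generator of NON-ZERO constant term of some
valuation `n` on every corner frame (`Three.CharTorsionAt₃` shape with `¬ Surj W 3`); supplied by lane B's
`Three.CornerCoStepLAt` (`cornerCharValuedAt_of_coStepLAt`) or by the control identity. TYPED, not attempted. -/
@[conjecture]
def CornerCharValuedAt : Prop :=
  ∀ (N : ℕ) [NeZero N] (K : Type) [Field K] [NumberField K] (Dt : ModularParametrizationData W N)
    (H : HeegnerDatum N (NumberField.discr K)) (ι : K →+* ℂ) (P : (W.baseChange K).toAffine.Point),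
    ClassX11b W 3 → ¬ Surj W 3 → W.conductorNorm ℤ = N → IsImaginaryQuadratic K →
    Odd (NumberField.discr K) → SatisfiesHeegnerHypothesis N K →
    (W.quadraticTwist (NumberField.discr K : ℚ)).entireLFunction 1 ≠ 0 →
    WeierstrassCurve.Affine.Point.map ι.toRatAlgHom P = heegnerPointComplex Dt H →
    ¬ (3 : ℤ) ∣ Dt.c → ¬ IsOfFinAddOrder P →
    ∀ (κ : ZpExtension K 3), κ.IsAnticyclotomic →
      ∀ (γ : Field.absoluteGaloisGroup K) [Fact (κ.IsTopGenerator γ)]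
        (𝔭 : HeightOneSpectrum (𝓞 K)), ((3 : ℕ) : 𝓞 K) ∈ 𝔭.asIdeal →
        𝔭.asIdeal.ramificationIdx (𝓞 ℚ) = 1 → 𝔭.asIdeal.inertiaDeg (𝓞 ℚ) = 1 →
        ∃ n : ℕ, XAc.HasCharValuationAt (W.baseChange K) 3 κ 𝔭 ∅ γ n

/-! ### §2 The candidate Props of this card (typed, not attempted; nothing asserted) -/

/-- **K1 (crux, rank 2) — the EISENSTEIN («⊆») divisibility UP TO A POWER OF `3`, ideal level, on the corner**:
on every corner frame and every Castella-normalised BDP frame `L ∈ R₀⟦T⟧` of the newform of `E`,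
`∃ k, ∀ g ∈ Ch_Λ(X_ac^∅)·R₀⟦T⟧, L ∣ 3^k · g`. SOURCE of the shape: Skinner–Urban 2014 Thm. 7.7 + Prop. 13.6(1)
(three-variable GU(2,2) divisibility under (irr_ℚ) alone, away from the height-one primes pulled back from `Λ_K⁺`;
quoted as Yan–Zhu 2026 Thm. 1.6), the Beilinson–Flach translation ordinary ↔ Greenberg (BSTW Prop. 9.18 = YZ Thm. 4.7,
tree flag `YZ26@3-BF-ERL-Ohta`) and the descent `γ⁺ ↦ 1` (YZ Lemma 2.3), under which a cyclotomic height-one prime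
becomes a non-zero constant of `R₀ = W(𝔽̄₃)`, i.e. `3^k · unit`. BEYOND PRINT at `3 ∥ N` (the printed chain is
good ordinary): the SU family of tame level `N/3` specialised at the `3`-Steinberg weight-2 point (Skinner 2016 §3
shape), the BF translation and the anticyclotomic control at `p ∥ N`. Why it might fail: a `p = 3 ∥ N` defect in the
SU Klingen–Eisenstein constant term / Gorenstein step (tree gap T13 `SU14-12.3.6-mu@nonsplit@3`) could leave an
error that is NOT a cyclotomic constant. TYPED, not attempted; nothing asserted. -/
@[conjecture]
def CornerLowerDivUpToPowerAt : Prop :=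
  ∀ (N : ℕ) [NeZero N] (K : Type) [Field K] [NumberField K] (Dt : ModularParametrizationData W N)
    (H : HeegnerDatum N (NumberField.discr K)) (ι : K →+* ℂ) (P : (W.baseChange K).toAffine.Point),
    ClassX11b W 3 → ¬ Surj W 3 → W.conductorNorm ℤ = N → IsImaginaryQuadratic K →
    Odd (NumberField.discr K) → SatisfiesHeegnerHypothesis N K →
    (W.quadraticTwist (NumberField.discr K : ℚ)).entireLFunction 1 ≠ 0 →
    WeierstrassCurve.Affine.Point.map ι.toRatAlgHom P = heegnerPointComplex Dt H →
    ¬ (3 : ℤ) ∣ Dt.c → ¬ IsOfFinAddOrder P →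
    ∀ (κ : ZpExtension K 3), κ.IsAnticyclotomic →
      ∀ (γ : Field.absoluteGaloisGroup K) [Fact (κ.IsTopGenerator γ)]
        (𝔭 : HeightOneSpectrum (𝓞 K)), ((3 : ℕ) : 𝓞 K) ∈ 𝔭.asIdeal →
        𝔭.asIdeal.ramificationIdx (𝓞 ℚ) = 1 → 𝔭.asIdeal.inertiaDeg (𝓞 ℚ) = 1 →
        ∀ (f : CuspForm (CongruenceSubgroup.Gamma0 N) 2), IsNewformOf W f →
          ∀ (ι' : PadicAlgCl 3 ≃+* ℂ), InducesPrime ι' 𝔭 →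
            ∀ (ΩK : ℂ) (Ωp : (unrIntegers 3)ˣ) (L : UnrSeries 3), ΩK ≠ 0 →
              IsBDPLFunction ι' 𝔭 κ γ f ΩK ((Ωp : unrIntegers 3) : ℂ_[3]) L →
                ∃ k : ℕ, ∀ g ∈ (XAc.charIdeal (W.baseChange K) 3 κ 𝔭 ∅ γ).map (PowerSeries.map (toUnr 3)),
                  L ∣ (C ((3 : ℕ) : unrIntegers 3)) ^ k * g

/-- **K2 (crux, rank 3; near-print) — `μ(L_𝔭^BDP) = 0` on the corner, in Hsieh's currency**: every
Castella-normalised BDP frame `L` of the newform of `E` on a corner frame has a coefficient of norm one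
(`L ≢ 0 mod 𝔪_{R₀}`). SOURCE: Hsieh, Doc. Math. 19 (2014) Thm. B (tree named fact
`Hsieh2014.thmB_exists_isHsiehLFunction_coeff_norm_eq_one`, binder `¬ p² ∣ N` only, `p` odd) — its hypothesis (2)
"`ρ̄|_{G_K}` absolutely irreducible" HOLDS on the corner (image `N(C_s) ≅ D₄` / `N(C_ns) ≅ SD₁₆`, `K ∩ ℚ(E[3]) = ℚ`
for odd Heegner `K`); remaining input = the comparison of Hsieh's frame with the Castella-normalised frame up to
`R₀⟦T⟧ˣ` (cell flag W2/CJM18). Why it might fail: only through that normalisation (a non-unit period ratio at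
`3 ∥ N`). TYPED, not attempted; nothing asserted. -/
@[conjecture]
def CornerBDPMuZeroAt : Prop :=
  ∀ (N : ℕ) [NeZero N] (K : Type) [Field K] [NumberField K] (Dt : ModularParametrizationData W N)
    (H : HeegnerDatum N (NumberField.discr K)) (ι : K →+* ℂ) (P : (W.baseChange K).toAffine.Point),
    ClassX11b W 3 → ¬ Surj W 3 → W.conductorNorm ℤ = N → IsImaginaryQuadratic K →
    Odd (NumberField.discr K) → SatisfiesHeegnerHypothesis N K →
    (W.quadraticTwist (NumberField.discr K : ℚ)).entireLFunction 1 ≠ 0 →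
    WeierstrassCurve.Affine.Point.map ι.toRatAlgHom P = heegnerPointComplex Dt H →
    ¬ (3 : ℤ) ∣ Dt.c → ¬ IsOfFinAddOrder P →
    ∀ (κ : ZpExtension K 3), κ.IsAnticyclotomic →
      ∀ (γ : Field.absoluteGaloisGroup K) [Fact (κ.IsTopGenerator γ)]
        (𝔭 : HeightOneSpectrum (𝓞 K)), ((3 : ℕ) : 𝓞 K) ∈ 𝔭.asIdeal →
        𝔭.asIdeal.ramificationIdx (𝓞 ℚ) = 1 → 𝔭.asIdeal.inertiaDeg (𝓞 ℚ) = 1 →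
        ∀ (f : CuspForm (CongruenceSubgroup.Gamma0 N) 2), IsNewformOf W f →
          ∀ (ι' : PadicAlgCl 3 ≃+* ℂ), InducesPrime ι' 𝔭 →
            ∀ (ΩK : ℂ) (Ωp : (unrIntegers 3)ˣ) (L : UnrSeries 3), ΩK ≠ 0 →
              IsBDPLFunction ι' 𝔭 κ γ f ΩK ((Ωp : unrIntegers 3) : ℂ_[3]) L →
                ∃ n : ℕ, ‖((PowerSeries.coeff n L : unrIntegers 3) : ℂ_[3])‖ = 1

/-- **Corner H3 — the INTEGRAL Eisenstein divisibility** (`Three.IMCDivAt₃ W` VERBATIM with `¬ Surj W 3`):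
`Ch_Λ(X_ac^∅)·R₀⟦T⟧ ⊆ (L)` on every corner frame and every BDP frame. The TARGET of K1 ∧ K2 (kernel below);
typed, not attempted; nothing asserted. -/
@[conjecture]
def CornerLowerDivAt : Prop :=
  ∀ (N : ℕ) [NeZero N] (K : Type) [Field K] [NumberField K] (Dt : ModularParametrizationData W N)
    (H : HeegnerDatum N (NumberField.discr K)) (ι : K →+* ℂ) (P : (W.baseChange K).toAffine.Point),
    ClassX11b W 3 → ¬ Surj W 3 → W.conductorNorm ℤ = N → IsImaginaryQuadratic K →
    Odd (NumberField.discr K) → SatisfiesHeegnerHypothesis N K →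
    (W.quadraticTwist (NumberField.discr K : ℚ)).entireLFunction 1 ≠ 0 →
    WeierstrassCurve.Affine.Point.map ι.toRatAlgHom P = heegnerPointComplex Dt H →
    ¬ (3 : ℤ) ∣ Dt.c → ¬ IsOfFinAddOrder P →
    ∀ (κ : ZpExtension K 3), κ.IsAnticyclotomic →
      ∀ (γ : Field.absoluteGaloisGroup K) [Fact (κ.IsTopGenerator γ)]
        (𝔭 : HeightOneSpectrum (𝓞 K)), ((3 : ℕ) : 𝓞 K) ∈ 𝔭.asIdeal →
        𝔭.asIdeal.ramificationIdx (𝓞 ℚ) = 1 → 𝔭.asIdeal.inertiaDeg (𝓞 ℚ) = 1 →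
        ∀ (f : CuspForm (CongruenceSubgroup.Gamma0 N) 2), IsNewformOf W f →
          ∀ (ι' : PadicAlgCl 3 ≃+* ℂ), InducesPrime ι' 𝔭 →
            ∀ (ΩK : ℂ) (Ωp : (unrIntegers 3)ˣ) (L : UnrSeries 3), ΩK ≠ 0 →
              IsBDPLFunction ι' 𝔭 κ γ f ΩK ((Ωp : unrIntegers 3) : ℂ_[3]) L →
                (XAc.charIdeal (W.baseChange K) 3 κ 𝔭 ∅ γ).map (PowerSeries.map (toUnr 3)) ≤
                  Ideal.span {L}

/-- **S2 (support) — Hsieh's Theorem B TRANSFERS to the Castella-normalised frame on the corner**: the tree's named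
fact (Doc. Math. 19 Thm. B, `p` odd, `¬ p² ∣ N`) implies K2 for every corner curve (content: the frame comparison
up to `R₀⟦T⟧ˣ` and the absolute irreducibility of `ρ̄|_{G_K}` on the corner). Typed as an implication between
Props; not attempted; nothing asserted. -/
@[conjecture]
def CornerHsiehTransferAt : Prop :=
  Hsieh2014.thmB_exists_isHsiehLFunction_coeff_norm_eq_one →
    ∀ (W : WeierstrassCurve ℚ) [W.IsElliptic] [W.IsGloballyMinimal], CornerBDPMuZeroAt W

/-- **S3 (support, PROVABLE) — Hsieh's hypothesis (2) HOLDS on every corner frame**: for a corner curve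
(`ρ̄_{E,3}` irreducible, non-surjective) and every imaginary quadratic `K` satisfying the STRICT Heegner hypothesis
for `N` (every `ℓ ∣ N` SPLIT in `K`, so `K` is unramified at every prime of `3N`), every framed mod-`3`
representation of `E/K` is absolutely irreducible. Informal proof: a quadratic `K ⊆ ℚ(E[3])` is unramified
outside `3N` (Néron–Ogg–Shafarevich), hence would be unramified everywhere — impossible (Minkowski); so
`K ∩ ℚ(E[3]) = ℚ`, `ρ̄(G_K) = ρ̄(G_ℚ) ∈ {N(C_s) ≅ D₄, N(C_ns) ≅ SD₁₆}` (Zywina 2015 Prop. 1.14 at `ℓ = 3`), both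
absolutely irreducible on `𝔽₃²`. CENSUS CHECK (card-C table `cartan3_detail.tsv` ⋈ `DH-census-rows.tsv.gz`): on
194/194 `3Ns` pairs the `3`-unramified Klein field `F_r ⊂ ℚ(E[3])` has `3` split and is a Heegner field for `N` on
0/194; on `3Nn` the only quadratic subfield unramified at `3` is real. Typed with Hsieh's binder VERBATIM; not
attempted here; nothing asserted. -/
@[conjecture]
def CornerAbsIrrOverKAt : Prop :=
  ∀ (N : ℕ) [NeZero N] (K : Type) [Field K] [NumberField K],
    ClassX11b W 3 → ¬ Surj W 3 → W.conductorNorm ℤ = N → IsImaginaryQuadratic K →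
    SatisfiesHeegnerHypothesis N K →
      ∀ ρ : ModPGaloisRep K (ZMod 3) 2, (W.baseChange K).IsTorsionGaloisRep 3 ρ →
        FramedRep.IsAbsolutelyIrreducible ρ

/-! ### §3 KERNEL (no sorry) -/

variable {W}

/-- **A norm-one coefficient forbids `3 ∣ L` in `R₀⟦T⟧`** (`3` is not a unit of `R₀`:
`CongruenceDescent.prime_natCast_p_unrIntegers`; units of `R₀` are its norm-one elements:
`unrIntegers.isUnit_iff_norm_eq_one`). [folklore] -/
theorem not_C_three_dvd_of_coeff_norm_eq_one {L : UnrSeries 3}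
    (h : ∃ n : ℕ, ‖((PowerSeries.coeff n L : unrIntegers 3) : ℂ_[3])‖ = 1) :
    ¬ (C ((3 : ℕ) : unrIntegers 3) : UnrSeries 3) ∣ L := by
  rintro ⟨h', rfl⟩
  obtain ⟨n, hn⟩ := h
  have hunit : IsUnit (PowerSeries.coeff n (C ((3 : ℕ) : unrIntegers 3) * h')) :=
    (unrIntegers.isUnit_iff_norm_eq_one _).mpr hn
  rw [PowerSeries.coeff_C_mul] at hunit
  exact (CongruenceDescent.prime_natCast_p_unrIntegers (p := 3)).not_unit (isUnit_of_mul_isUnit_left hunit)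

/-- **The laundering step, pure `R₀⟦T⟧`-algebra**: `L ∣ 3^k g` and `3 ∤ L` ⟹ `L ∣ g` (`R₀` a domain, `3` prime;
the tree's `CastellaGrossiSkinner2025.dvd_of_mul_eq_C_pow_mul` at `μ = 0`). [folklore] -/
theorem dvd_of_dvd_C_pow_mul_of_not_C_dvd {L g : UnrSeries 3} {k : ℕ}
    (hdiv : L ∣ (C ((3 : ℕ) : unrIntegers 3)) ^ k * g) (hμ : ¬ (C ((3 : ℕ) : unrIntegers 3) : UnrSeries 3) ∣ L) :
    L ∣ g := by
  obtain ⟨h, hh⟩ := hdiv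
  have hπ : Prime ((3 : ℕ) : unrIntegers 3) := CongruenceDescent.prime_natCast_p_unrIntegers (p := 3)
  refine CastellaGrossiSkinner2025.dvd_of_mul_eq_C_pow_mul (μ := 0) hπ ?_ ?_ hh.symm
  · simpa only [zero_add, pow_one] using hμ
  · intro j hj
    rcases j with _ | j
    · simp only [pow_zero, one_dvd]
    · exact absurd ((dvd_pow_self _ (Nat.succ_ne_zero j)).trans hj) hμ

omit [W.IsElliptic] [W.IsGloballyMinimal] in
/-- **KERNEL — K1 ∧ K2 ⟹ the INTEGRAL Eisenstein divisibility on the corner** (corner H3). [folklore] -/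
theorem cornerLowerDivAt_of_upToPower_of_muZero (h1 : CornerLowerDivUpToPowerAt W) (h2 : CornerBDPMuZeroAt W) :
    CornerLowerDivAt W := by
  intro N _ K _ _ Dt H ι P hX hns hN hK hodd hheeg hL1 hP hc hP0 κ hκ γ _ 𝔭 h𝔭 he hf f hfW ι' hι' ΩK Ωp
    L hΩK hL
  obtain ⟨k, hk⟩ := h1 N K Dt H ι P hX hns hN hK hodd hheeg hL1 hP hc hP0 κ hκ γ 𝔭 h𝔭 he hf f hfW ι' hι'
    ΩK Ωp L hΩK hL
  have hμ := not_C_three_dvd_of_coeff_norm_eq_one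
    (h2 N K Dt H ι P hX hns hN hK hodd hheeg hL1 hP hc hP0 κ hκ γ 𝔭 h𝔭 he hf f hfW ι' hι' ΩK Ωp L hΩK hL)
  intro g hg
  exact Ideal.mem_span_singleton.mpr (dvd_of_dvd_C_pow_mul_of_not_C_dvd (hk g hg) hμ)

/-- **KERNEL — the corner halves assembly** (`Three.stepLAt_of_halves₃` VERBATIM with `¬ Surj W 3`): newform supply +
CTL₀ + H1 + H2 + H3 on the corner ⟹ `Three.CornerStepLAt W`. [folklore] -/
theorem cornerStepLAt_of_halves (hnf : exists_isNewformOf) (hctl : CornerCharValuedAt W)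
    (h1 : CornerBDPExistsAt W) (h2 : CornerBDPValueAt W) (h3 : CornerLowerDivAt W) : CornerStepLAt W := by
  intro N _ K _ _ Dt H ι P hX hns hN hK hodd hheeg hL1 hP hc hP0 κ hκ γ _ 𝔭 h𝔭 he hf
  subst hN
  obtain ⟨f, hfW⟩ := hnf W
  obtain ⟨ι', hι', ΩK, Ωp, L, hΩK, hL⟩ :=
    h1 _ K Dt H ι P hX hns rfl hK hodd hheeg hL1 hP hc hP0 κ hκ γ 𝔭 h𝔭 he hf f hfW
  obtain ⟨u, hu⟩ :=
    h2 _ K Dt H ι P hX hns rfl hK hodd hheeg hL1 hP hc hP0 κ hκ γ 𝔭 h𝔭 he hf f hfW ι' hι' ΩK Ωp L hΩK hL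
  have hdiv :=
    h3 _ K Dt H ι P hX hns rfl hK hodd hheeg hL1 hP hc hP0 κ hκ γ 𝔭 h𝔭 he hf f hfW ι' hι' ΩK Ωp L hΩK hL
  obtain ⟨n, hn⟩ := hctl _ K Dt H ι P hX hns rfl hK hodd hheeg hL1 hP hc hP0 κ hκ γ 𝔭 h𝔭 he hf
  exact imcLowerWaldspurgerOnTreeAt_of_value_of_dvd hn hdiv u (W.LFunction 3) hu

/-- **KERNEL — the μ-calibrated Eisenstein package decides the STEP L conjunct of the crux for `W`**:
newform supply + CTL₀ + H1 + H2 + K1 + K2 ⟹ `Three.CornerStepLAt W`. CONDITIONAL on the displayed inputs;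
nothing booked. [folklore] -/
theorem cornerStepLAt_of_muCalibration (hnf : exists_isNewformOf) (hctl : CornerCharValuedAt W)
    (h1 : CornerBDPExistsAt W) (h2 : CornerBDPValueAt W) (hK1 : CornerLowerDivUpToPowerAt W)
    (hK2 : CornerBDPMuZeroAt W) : CornerStepLAt W :=
  cornerStepLAt_of_halves hnf hctl h1 h2 (cornerLowerDivAt_of_upToPower_of_muZero hK1 hK2)

/-- **KERNEL — class-wide form, concluding the registered stub constant `Theorems.CornerAtThreeStepL`** (the type of
the XL stub `stub_cornerStepL3` of `Cruxes/CornerAtThreeW/Lines/inert.lean`), with K2 supplied through Hsieh's named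
fact and the transfer S2. [folklore] -/
theorem cornerAtThreeStepL_of_muCalibration (hnf : exists_isNewformOf)
    (hctl : ∀ (W : WeierstrassCurve ℚ) [W.IsElliptic] [W.IsGloballyMinimal], CornerCharValuedAt W)
    (h1 : ∀ (W : WeierstrassCurve ℚ) [W.IsElliptic] [W.IsGloballyMinimal], CornerBDPExistsAt W)
    (h2 : ∀ (W : WeierstrassCurve ℚ) [W.IsElliptic] [W.IsGloballyMinimal], CornerBDPValueAt W)
    (hK1 : ∀ (W : WeierstrassCurve ℚ) [W.IsElliptic] [W.IsGloballyMinimal], CornerLowerDivUpToPowerAt W)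
    (hHsieh : Hsieh2014.thmB_exists_isHsiehLFunction_coeff_norm_eq_one) (hS2 : CornerHsiehTransferAt) :
    Summit.BirchSwinnertonDyer.BirchSwinnertonDyer.Theorems.CornerAtThreeStepL := by
  intro W _ _
  exact cornerStepLAt_of_muCalibration hnf (hctl W) (h1 W) (h2 W) (hK1 W) (hS2 hHsieh W)

end Summit.BirchSwinnertonDyer.BirchSwinnertonDyer.Cruxes.CornerAtThreeW.MuCalibratedEisenstein

end
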